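import Summits.HubbardSuperconductivity.HubbardSuperconductivity.Theses.CooperPairDMottWalk
import Summits.HubbardSuperconductivity.HubbardSuperconductivity.Theorems.TwTipContinuation.Negative.TipNormalForm

/-!
# Crux `DiluteBECBridge` (stmt-HubbardSuperconductivity-10314) in NORMAL FORM, and necessity of stub B of line `birth`

Helper for route `CooperPairDMottWalk` (`--supports stmt-HubbardSuperconductivity-10314`; the crux is
shared verbatim with route `HyperoctahedralMott`). The crux reads
`∀ U ∈ [2,8], CP(U) → ∃ δ ∈ (0, 1/2), SummitBody(U, δ)`, where `CP(U)` is the `L`-uniform pure-model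
Cooper pair (clauses (a) binding, (b) unique two-hole ground state, (c) macroscopic `d_{x²-y²}` pair
amplitude on the sides `4k+4`) and `SummitBody(U, δ)` is the summit's conclusion at fixed `(U, δ)`:
`d_{x²-y²}` pair-field long-range order (a `liminf` over the even sides) of EVERY admissible sequence of
normalised `(2⌊(1-δ)L²/2⌋, S^z = 0)`-sector ground states of `hubbardTorus 2 L 1 U`.

By the tree's normal form `summitMatrix_iff_everyGSOrder`
(`Theorems/TwTipContinuation/Negative/TipNormalForm.lean`, `δ ≥ -1`; hard half by a diagonal of
near-worst ground states), `SummitBody(U, δ)` is EQUIVALENT to the finite-volume, uniform,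
every-ground-state floor
`VO(U, δ) := ∃ c > 0, ∃ L₁, ∀ L ≥ L₁ (L ≠ 0, even), ∀ unit sector ground state ψ, c·L⁴ ≤ re ⟨ψ, Δ_d† Δ_d ψ⟩`,
which is LITERALLY the conclusion `VO U δ` of stub B (`stub_dilutePairCondensation`) of the registered
line `birth` (`Cruxes/DiluteBECBridge/Lines/birth.lean`). Hence, on the literal route term:

* `diluteBECBridge_iff_everyGSOrder` — **the crux in normal form**:
  `DiluteBECBridge ↔ ∀ U ∈ [2,8], CP(U) → ∃ δ ∈ (0, 1/2), VO(U, δ)`;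
* `diluteBECBridge_volumeOrder_of_conclusion` — **necessity of stub B's body**: the crux's own
  conclusion at `(U, δ)`, `δ > 0`, implies `VO(U, δ)` at the same `δ`;
* `diluteBECBridge_of_condensation` — the single `CP`-guarded statement
  `∀ U ∈ [2,8], CP(U) → ∃ δ ∈ (0,1/2), VO(U, δ)` closes the crux with stub R
  (`stub_pairGapPersists`, the pairing gap) IDLE (and, by the `↔`, is implied back by the crux).

Reading for planners re-lining the crux: the decomposition R ∧ B ⇒ crux of line `birth`
(`diluteBECBridge_of_pairGap_of_condensation`, landed) does not lower the crux — B at the doping where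
it is consumed IS the crux's conclusion, and R only restricts the dopings at which B is asked. Any line
must produce, from the two-hole data `CP(U)` alone, a doping `δ` with a UNIFORM volume-order floor over
all sector ground states; no theorem in tree or print carries information from the `L²`, `L² - 1`,
`L² - 2` sectors to hole density `δ > 0`. References: S. Friedli, Y. Velenik (2017) §3.7.2 (LRO as a
liminf); D. J. Scalapino, Phys. Rep. 250 (1995) 329, §2 eq. (2.4). No definition is introduced.
-/

-- the mandated namespace `Summit.<Summit>.<Problem>.Theorems` repeats `HubbardSuperconductivity`
-- (single-problem summit, D-0017), which the `dupNamespace` linter flags on every declaration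
set_option linter.dupNamespace false

noncomputable section

namespace Summit.HubbardSuperconductivity.HubbardSuperconductivity.Theorems.CooperPairDMottWalk

open Matrix Filter
open Literature.Probability.LatticeModels Literature.MathematicalPhysics.QuantumLattice
open Summit.HubbardSuperconductivity.HubbardSuperconductivity.Theses.CooperPairDMottWalk
open Summit.HubbardSuperconductivity.TwTipContinuation.Negative
  (summitMatrix_iff_everyGSOrder everyGSOrder_of_summitMatrix summitMatrix_of_everyGSOrder)
open scoped ComplexOrder

/-- **Necessity of stub B's body (line `birth`).** The crux's conclusion at `(U, δ)` — `d`-wave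
pair-field long-range order of every admissible `(2⌊(1-δ)L²/2⌋, S^z = 0)` ground-state sequence of
the pure torus along the even sides — forces, for `δ > 0` (indeed `δ ≥ -1`), the every-ground-state
volume-order floor `VO(U, δ)` that stub `stub_dilutePairCondensation` concludes: otherwise a diagonal
of near-worst ground states is an admissible sequence with `liminf ≤ 0`
(`everyGSOrder_of_summitMatrix`). So B, at any doping where it is consumed, is not cheaper than the
crux's conclusion there. [cite: FriedliVelenik2017, §3.7.2 Definition 3.27] -/
theorem diluteBECBridge_volumeOrder_of_conclusion :
    ∀ (U δ : ℝ), 0 < δ →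
      (∀ (N : ℕ → ℕ) (ψ : ∀ L, Fock (Orb (FermionTorus 2 L))),
        (∀ L, Even L → N L = 2 * ⌊(1 - δ) * (L : ℝ) ^ 2 / 2⌋₊ ∧ star (ψ L) ⬝ᵥ ψ L = 1 ∧
            IsGroundStateInSector (hubbardTorus 2 L 1 U) (N L) 0 (ψ L)) →
          HasLongRangeOrder (fun k => halfOpenBox 2 (2 * k))
            (fun k => torusPullback (pairFieldCorr dWaveFormFactor ψ) (2 * k))) →
      ∃ c > (0 : ℝ), ∃ L₁ : ℕ, ∀ (L : ℕ) [NeZero L], L₁ ≤ L → Even L →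
        ∀ ψ : Fock (Orb (FermionTorus 2 L)), star ψ ⬝ᵥ ψ = 1 →
          IsGroundStateInSector (hubbardTorus 2 L 1 U) (2 * ⌊(1 - δ) * (L : ℝ) ^ 2 / 2⌋₊) 0 ψ →
            c * (L : ℝ) ^ 4 ≤
              (expect ((pairField dWaveFormFactor L)ᴴ * pairField dWaveFormFactor L) ψ).re := by
  intro U δ hδ hS
  obtain ⟨c, hc, L₀, hL⟩ := everyGSOrder_of_summitMatrix (U := U) (δ := δ) (by linarith) hS
  exact ⟨c, hc, L₀, hL⟩

/-- **`DiluteBECBridge` in normal form.** The BEC-side bridge of route `CooperPairDMottWalk` is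
equivalent to: for every `U ∈ [2, 8]`, the `L`-uniform pure-model Cooper pair `CP(U)` (clauses
(a) binding, (b) unique two-hole ground state, (c) macroscopic `d`-wave pair amplitude, sides `4k+4`)
implies a doping `δ ∈ (0, 1/2)` and a constant `c > 0` such that, eventually in even `L`, EVERY
normalised ground state `ψ` of `hubbardTorus 2 L 1 U` in the sector `(2⌊(1-δ)L²/2⌋, S^z = 0)` obeys
the volume-order floor `c·L⁴ ≤ re ⟨ψ, Δ_d† Δ_d ψ⟩` (`Δ_d = pairField dWaveFormFactor L`) — the
conclusion `VO U δ` of stub B of line `birth`. Pointwise in `(U, δ)` this is the tree's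
`summitMatrix_iff_everyGSOrder` (`δ > 0 ≥ -1`). [cite: Scalapino1995, §2 eq. (2.4)] -/
theorem diluteBECBridge_iff_everyGSOrder :
    DiluteBECBridge ↔
      (let CP := fun (L : ℕ) [NeZero L]
          (H : Matrix (Finset (Orb (FermionTorus 2 L))) (Finset (Orb (FermionTorus 2 L))) ℂ)
          (ε z : ℝ) =>
        H.minEnergyOn (szSector (L ^ 2 - 2) 0) + H.minEnergyOn (szSector (L ^ 2) 0) + ε ≤
            2 * H.minEnergyOn (szSector (L ^ 2 - 1) (1 / 2)) ∧
          (∀ φ₁ φ₂, IsGroundStateInSector H (L ^ 2 - 2) 0 φ₁ →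
            IsGroundStateInSector H (L ^ 2 - 2) 0 φ₂ → ∃ c : ℂ, φ₂ = c • φ₁) ∧
          (∀ φ₀ φ₂, IsGroundStateInSector H (L ^ 2) 0 φ₀ →
            IsGroundStateInSector H (L ^ 2 - 2) 0 φ₂ →
              z * (L : ℝ) ^ 2 * (star φ₀ ⬝ᵥ φ₀).re * (star φ₂ ⬝ᵥ φ₂).re ≤
                ‖star φ₂ ⬝ᵥ (pairField dWaveFormFactor L *ᵥ φ₀)‖ ^ 2);
      let VO := fun (U δ : ℝ) =>
        ∃ c > (0 : ℝ), ∃ L₁ : ℕ, ∀ (L : ℕ) [NeZero L], L₁ ≤ L → Even L →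
          ∀ ψ : Fock (Orb (FermionTorus 2 L)), star ψ ⬝ᵥ ψ = 1 →
            IsGroundStateInSector (hubbardTorus 2 L 1 U) (2 * ⌊(1 - δ) * (L : ℝ) ^ 2 / 2⌋₊) 0 ψ →
              c * (L : ℝ) ^ 4 ≤
                (expect ((pairField dWaveFormFactor L)ᴴ * pairField dWaveFormFactor L) ψ).re;
      ∀ U ∈ Set.Icc (2 : ℝ) 8,
        (∃ ε > (0 : ℝ), ∃ z > (0 : ℝ), ∃ k₀ : ℕ, ∀ k ≥ k₀,
            CP (4 * k + 4) (hubbardTorus 2 (4 * k + 4) 1 U) ε z) →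
          ∃ δ ∈ Set.Ioo (0 : ℝ) (1 / 2), VO U δ) := by
  dsimp only [DiluteBECBridge]
  constructor
  · intro h U hU hCP
    obtain ⟨δ, hδ, hS⟩ := h U hU hCP
    exact ⟨δ, hδ, diluteBECBridge_volumeOrder_of_conclusion U δ hδ.1 hS⟩
  · intro h U hU hCP
    obtain ⟨δ, hδ, c, hc, L₁, hL⟩ := h U hU hCP
    exact ⟨δ, hδ, summitMatrix_of_everyGSOrder ⟨c, hc, L₁, hL⟩⟩

/-- **The single-stub skeleton (R idle).** The `CP`-guarded condensation statement
`∀ U ∈ [2,8], CP(U) → ∃ δ ∈ (0, 1/2), VO(U, δ)` — stub B of line `birth` asked at ONE doping and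
without its pairing-gap premise — already yields `DiluteBECBridge` by name; stub R
(`stub_pairGapPersists`) is not consumed. [cite: Scalapino1995, §2 eq. (2.4)] -/
theorem diluteBECBridge_of_condensation :
    (let CP := fun (L : ℕ) [NeZero L]
          (H : Matrix (Finset (Orb (FermionTorus 2 L))) (Finset (Orb (FermionTorus 2 L))) ℂ)
          (ε z : ℝ) =>
        H.minEnergyOn (szSector (L ^ 2 - 2) 0) + H.minEnergyOn (szSector (L ^ 2) 0) + ε ≤
            2 * H.minEnergyOn (szSector (L ^ 2 - 1) (1 / 2)) ∧
          (∀ φ₁ φ₂, IsGroundStateInSector H (L ^ 2 - 2) 0 φ₁ →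
            IsGroundStateInSector H (L ^ 2 - 2) 0 φ₂ → ∃ c : ℂ, φ₂ = c • φ₁) ∧
          (∀ φ₀ φ₂, IsGroundStateInSector H (L ^ 2) 0 φ₀ →
            IsGroundStateInSector H (L ^ 2 - 2) 0 φ₂ →
              z * (L : ℝ) ^ 2 * (star φ₀ ⬝ᵥ φ₀).re * (star φ₂ ⬝ᵥ φ₂).re ≤
                ‖star φ₂ ⬝ᵥ (pairField dWaveFormFactor L *ᵥ φ₀)‖ ^ 2);
      let VO := fun (U δ : ℝ) =>
        ∃ c > (0 : ℝ), ∃ L₁ : ℕ, ∀ (L : ℕ) [NeZero L], L₁ ≤ L → Even L →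
          ∀ ψ : Fock (Orb (FermionTorus 2 L)), star ψ ⬝ᵥ ψ = 1 →
            IsGroundStateInSector (hubbardTorus 2 L 1 U) (2 * ⌊(1 - δ) * (L : ℝ) ^ 2 / 2⌋₊) 0 ψ →
              c * (L : ℝ) ^ 4 ≤
                (expect ((pairField dWaveFormFactor L)ᴴ * pairField dWaveFormFactor L) ψ).re;
      ∀ U ∈ Set.Icc (2 : ℝ) 8,
        (∃ ε > (0 : ℝ), ∃ z > (0 : ℝ), ∃ k₀ : ℕ, ∀ k ≥ k₀,
            CP (4 * k + 4) (hubbardTorus 2 (4 * k + 4) 1 U) ε z) →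
          ∃ δ ∈ Set.Ioo (0 : ℝ) (1 / 2), VO U δ) →
    DiluteBECBridge :=
  fun hB => diluteBECBridge_iff_everyGSOrder.2 hB


end Summit.HubbardSuperconductivity.HubbardSuperconductivity.Theorems.CooperPairDMottWalk

end
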